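import Mathlib
import Summits.Ventures.PercRepro2.HCov
import Summits.Ventures.PercRepro2.BHKEvents
import Summits.Ventures.PercRepro2.A3Fibre
import Summits.Ventures.PercRepro2.A3FibreLeft
import Summits.Ventures.PercRepro2.A3FibreMain
import Summits.Ventures.PercRepro2.A3RootEdge
import Summits.Ventures.PercRepro2.A3RootEdgeFibre
import Summits.Ventures.PercRepro2.A3RootEdgeMeans
import Summits.Ventures.PercRepro2.A3RootEdgeClusterFns

/-!
# The means functional at `p[e ↦ 1]` is nonnegative: BHK 1.3 for two increasing cluster functions
(blind cell PercRepro2, p5 g13; `proofs/P5-ROOTEDGE.md` §6, third block)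

For a root edge `e = {a₁, a₃}`, at `p₁ = p[e ↦ 1]` the (MEANS-a₃) functional `btwg p₁ γ` is a
covariance of two INCREASING functions of the cluster `C(a₃) = C(a₁)` under `Q` — `cbS` (the `b`-mean)
and `cFS` (the `F`-mean at a constant `γ ≥ 0`) — so **`btwg_one_nonneg : 0 ≤ btwg p₁ γ`** by BHK 1.3
for monotone functions (`bhk_same_cluster`), through the fibre-sum form of an expectation
(`expect_cluster_mul_indicator`) and the identification of the fibres at `p₁`
(`prob_one_cluster_inter_eq_mW`, `prob_one_compl_conn_eq_Q`); the cluster functions `cbS`, `cFS` and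
their monotonicity are in `A3RootEdgeClusterFns.lean`.
-/

namespace Summit.Ventures.PercRepro2

open UnionCluster

namespace CovForm

namespace RootEdge

open CCT A3Fibre

section Between

open Classical

variable {V : Type*} {E : Type*} [Fintype V] [DecidableEq V] [Fintype E] [DecidableEq E]
  {R : Type*} [Field R] [LinearOrder R] [IsStrictOrderedRing R]

/-! ### Expectations of cluster functions as fibre sums -/

omit [DecidableEq V] [LinearOrder R] [IsStrictOrderedRing R] in
/-- `E[F(C(a₃)) · 1_X] = ∑_W F(W) · P(C(a₃) = W, X)`. -/
lemma expect_cluster_mul_indicator (p : E → R) (ends : E → Sym2 V) (a₃ : V) (F : Set V → R)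
    (X : Set (Config E)) :
    expect p (fun ω => F (cluster ends ω a₃) * X.indicator 1 ω) =
      ∑ W : Finset V, F (↑W : Set V) * prob p (clusterEvent ends a₃ (↑W : Set V) ∩ X) := by
  unfold expect prob
  simp_rw [Finset.mul_sum]
  rw [Finset.sum_comm]
  refine Finset.sum_congr rfl fun ω _ => ?_
  rw [Finset.sum_eq_single (clusterFinset ends ω a₃)]
  · rw [coe_clusterFinset]
    by_cases hX : ω ∈ X
    · have hmem : ω ∈ clusterEvent ends a₃ (cluster ends ω a₃) ∩ X := ⟨rfl, hX⟩
      rw [Set.indicator_of_mem hmem, Set.indicator_of_mem hX]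
      simp only [Pi.one_apply]
      ring
    · have hnot : ω ∉ clusterEvent ends a₃ (cluster ends ω a₃) ∩ X := fun h => hX h.2
      rw [Set.indicator_of_notMem hnot, Set.indicator_of_notMem hX]
      ring
  · intro W _ hW
    rw [Set.indicator_of_notMem]
    · ring
    · rintro ⟨h1, _⟩
      apply hW
      apply Finset.coe_injective
      rw [coe_clusterFinset, mem_clusterEvent.1 h1]
  · intro h
    exact absurd (Finset.mem_univ _) h

variable {ends : E → Sym2 V} {e : E} {a₁ a₂ a₃ : V}

omit [Fintype V] [DecidableEq V] [LinearOrder R] [IsStrictOrderedRing R] in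
/-- At `p[e ↦ 1]`, `{a₃ ↮ a₂} ∩ {C(a₃) = W}` is the fibre `Q ∩ {C(a₃) = W}`. -/
lemma prob_one_cluster_inter_eq_mW (p : E → R) (hends : ends e = s(a₁, a₃)) (W : Finset V) :
    prob (Function.update p e 1) (clusterEvent ends a₃ (↑W : Set V) ∩ (connEvent ends a₃ a₂)ᶜ) =
      mW (Function.update p e 1) ends a₁ a₂ a₃ W := by
  unfold mW fibre
  rw [prob_update_one_eq, prob_update_one_eq]
  congr 1
  ext ω
  have h13 := conn_update_true hends ω
  simp only [Set.mem_setOf_eq, Set.mem_inter_iff, Set.mem_compl_iff, mem_connEvent, mem_avoidAll,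
    Finset.mem_singleton, forall_eq]
  constructor
  · rintro ⟨hc, h32⟩
    exact ⟨fun h21 => h32 (conn_trans (conn_symm h13) (conn_symm h21)), hc⟩
  · rintro ⟨h21, hc⟩
    exact ⟨hc, fun h32 => h21 (conn_trans (conn_symm h32) (conn_symm h13))⟩

omit [Fintype V] [DecidableEq V] [LinearOrder R] [IsStrictOrderedRing R] in
/-- At `p[e ↦ 1]`, `P(a₃ ↮ a₂) = P(Q)`. -/
lemma prob_one_compl_conn_eq_Q (p : E → R) (hends : ends e = s(a₁, a₃)) :
    prob (Function.update p e 1) (connEvent ends a₃ a₂)ᶜ =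
      prob (Function.update p e 1) (avoidAll ends a₂ {a₁}) := by
  rw [prob_update_one_eq, prob_update_one_eq]
  congr 1
  ext ω
  have h13 := conn_update_true hends ω
  simp only [Set.mem_setOf_eq, Set.mem_compl_iff, mem_connEvent, mem_avoidAll,
    Finset.mem_singleton, forall_eq]
  exact ⟨fun h32 h21 => h32 (conn_trans (conn_symm h13) (conn_symm h21)),
    fun h21 h32 => h21 (conn_trans (conn_symm h32) (conn_symm h13))⟩

/-! ### The fibre masses at `p[e ↦ 1]` -/

omit [Fintype V] [DecidableEq V] [LinearOrder R] [IsStrictOrderedRing R] in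
/-- `Ssig` vanishes at `p[e ↦ 1]` off the `T′`-fibres. -/
lemma Ssig_one_of_notMem (p : E → R) (hends : ends e = s(a₁, a₃)) {W : Finset V} (h₁ : a₁ ∉ W)
    (v : V) : Ssig (Function.update p e 1) ends a₁ a₂ a₃ v W = 0 := by
  unfold Ssig
  simp only [prob_one_fibre_inter p hends h₁]
  ring

omit [Fintype V] [DecidableEq V] [LinearOrder R] [IsStrictOrderedRing R] in
/-- `Su` vanishes at `p[e ↦ 1]` off the `T′`-fibres. -/
lemma Su_one_of_notMem (p : E → R) (hends : ends e = s(a₁, a₃)) {W : Finset V} (h₁ : a₁ ∉ W)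
    (v : V) : Su (Function.update p e 1) ends a₁ a₂ a₃ v W = 0 := by
  unfold Su
  simp only [prob_one_fibre_inter p hends h₁]
  ring

omit [LinearOrder R] [IsStrictOrderedRing R] in
/-- `Ssig` at `p[e ↦ 1]` is `mW₁ · cbS` on every fibre. -/
lemma Ssig_one_eq (p : E → R) (hends : ends e = s(a₁, a₃)) (b : V) (W : Finset V) :
    Ssig (Function.update p e 1) ends a₁ a₂ a₃ b W =
      mW (Function.update p e 1) ends a₁ a₂ a₃ W * cbS p ends a₂ b (↑W : Set V) := by
  rw [cbS_coe]
  by_cases h₁ : a₁ ∈ W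
  · by_cases h₂ : a₂ ∈ W
    · have hm : mW (Function.update p e 1) ends a₁ a₂ a₃ W = 0 := by
        unfold mW; rw [fibre_eq_empty_of_mem_mem ends a₁ a₂ a₃ h₁ h₂, prob_empty]
      have hs : Ssig (Function.update p e 1) ends a₁ a₂ a₃ b W = 0 := by
        unfold Ssig; rw [fibre_eq_empty_of_mem_mem ends a₁ a₂ a₃ h₁ h₂]; simp
      rw [hm, hs]; ring
    · exact Ssig_update_eq_mul p hends h₁ h₂ b 1
  · rw [mW_one_of_notMem p hends h₁, Ssig_one_of_notMem p hends h₁]; ring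

omit [LinearOrder R] [IsStrictOrderedRing R] in
/-- `SFg` at `p[e ↦ 1]` is `mW₁ · cFS` on every fibre. -/
lemma SFg_one_eq (p : E → R) (hends : ends e = s(a₁, a₃)) (o : V) (γ : R) (W : Finset V) :
    SFg (Function.update p e 1) ends o a₁ a₂ a₃ γ W =
      mW (Function.update p e 1) ends a₁ a₂ a₃ W * cFS p ends a₂ o γ (↑W : Set V) := by
  rw [cFS_coe]
  by_cases h₁ : a₁ ∈ W
  · by_cases h₂ : a₂ ∈ W
    · have hm : mW (Function.update p e 1) ends a₁ a₂ a₃ W = 0 := by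
        unfold mW; rw [fibre_eq_empty_of_mem_mem ends a₁ a₂ a₃ h₁ h₂, prob_empty]
      have hs : SFg (Function.update p e 1) ends o a₁ a₂ a₃ γ W = 0 := by
        unfold SFg Ssig Su mW; rw [fibre_eq_empty_of_mem_mem ends a₁ a₂ a₃ h₁ h₂]; simp
      rw [hm, hs]; ring
    · have hs3 : s3 a₁ a₂ W = (1 : R) := by simp [s3, h₁]
      unfold SFg
      rw [Ssig_update_eq_mul p hends h₁ h₂ o 1, Su_update_eq_mul p hends h₁ h₂ o 1, hs3]
      split_ifs <;> ring
  · unfold SFg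
    rw [Ssig_one_of_notMem p hends h₁, Su_one_of_notMem p hends h₁, mW_one_of_notMem p hends h₁]
    ring

omit [LinearOrder R] [IsStrictOrderedRing R] in
/-- The `Ssig·SFg/mW` term at `p[e ↦ 1]` is `mW₁ · cbS · cFS`. -/
lemma term_one_eq (p : E → R) (hends : ends e = s(a₁, a₃)) (o b : V) (γ : R) (W : Finset V) :
    Ssig (Function.update p e 1) ends a₁ a₂ a₃ b W * SFg (Function.update p e 1) ends o a₁ a₂ a₃ γ W /
        mW (Function.update p e 1) ends a₁ a₂ a₃ W =
      mW (Function.update p e 1) ends a₁ a₂ a₃ W *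
        (cbS p ends a₂ b (↑W : Set V) * cFS p ends a₂ o γ (↑W : Set V)) := by
  rw [Ssig_one_eq p hends b W, SFg_one_eq p hends o γ W, mul_mul_div_self]

/-! ### The three fibre sums at `p[e ↦ 1]` as expectations -/

omit [LinearOrder R] [IsStrictOrderedRing R] in
/-- The `Ssig·SFg/mW` sum at `p[e ↦ 1]` as an expectation. -/
lemma sum_term_one_eq_expect (p : E → R) (hends : ends e = s(a₁, a₃)) (o b : V) (γ : R) :
    (∑ W : Finset V, Ssig (Function.update p e 1) ends a₁ a₂ a₃ b W *
        SFg (Function.update p e 1) ends o a₁ a₂ a₃ γ W / mW (Function.update p e 1) ends a₁ a₂ a₃ W) =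
      expect (Function.update p e 1) (fun ω =>
        (cbS p ends a₂ b (cluster ends ω a₃) * cFS p ends a₂ o γ (cluster ends ω a₃)) *
          ((connEvent ends a₃ a₂)ᶜ).indicator 1 ω) := by
  have h := expect_cluster_mul_indicator (Function.update p e 1) ends a₃
    (fun S => cbS p ends a₂ b S * cFS p ends a₂ o γ S) ((connEvent ends a₃ a₂)ᶜ)
  rw [h]
  refine Finset.sum_congr rfl fun W _ => ?_
  rw [term_one_eq p hends o b γ W, prob_one_cluster_inter_eq_mW p hends W]
  ring

omit [LinearOrder R] [IsStrictOrderedRing R] in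
/-- The `Ssig` sum at `p[e ↦ 1]` as an expectation. -/
lemma sum_Ssig_one_eq_expect (p : E → R) (hends : ends e = s(a₁, a₃)) (b : V) :
    (∑ W : Finset V, Ssig (Function.update p e 1) ends a₁ a₂ a₃ b W) =
      expect (Function.update p e 1) (fun ω =>
        cbS p ends a₂ b (cluster ends ω a₃) * ((connEvent ends a₃ a₂)ᶜ).indicator 1 ω) := by
  rw [expect_cluster_mul_indicator]
  refine Finset.sum_congr rfl fun W _ => ?_
  rw [Ssig_one_eq p hends b W, prob_one_cluster_inter_eq_mW p hends W]
  ring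

omit [LinearOrder R] [IsStrictOrderedRing R] in
/-- The `SFg` sum at `p[e ↦ 1]` as an expectation. -/
lemma sum_SFg_one_eq_expect (p : E → R) (hends : ends e = s(a₁, a₃)) (o : V) (γ : R) :
    (∑ W : Finset V, SFg (Function.update p e 1) ends o a₁ a₂ a₃ γ W) =
      expect (Function.update p e 1) (fun ω =>
        cFS p ends a₂ o γ (cluster ends ω a₃) * ((connEvent ends a₃ a₂)ᶜ).indicator 1 ω) := by
  rw [expect_cluster_mul_indicator]
  refine Finset.sum_congr rfl fun W _ => ?_
  rw [SFg_one_eq p hends o γ W, prob_one_cluster_inter_eq_mW p hends W]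
  ring

/-- **`btwg p[e ↦ 1] γ ≥ 0`** for `γ ≥ 0`: BHK 1.3 for the monotone functions `cbS`, `cFS` of `C(a₃)`. -/
theorem btwg_one_nonneg (p : E → R) (hp : IsProbVec p) (hends : ends e = s(a₁, a₃)) (o b : V)
    {γ : R} (hγ : 0 ≤ γ) : 0 ≤ btwg (Function.update p e 1) ends o a₁ a₂ a₃ b γ := by
  have hp₁ : IsProbVec (Function.update p e 1) := hp.update e zero_le_one le_rfl
  -- BHK 1.3 for the shifted nonnegative monotone functions
  have key := bhk_same_cluster (Function.update p e 1) hp₁ ends a₃ a₂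
    (F₁ := fun S => cbS p ends a₂ b S + 1) (F₂ := fun S => cFS p ends a₂ o γ S + 2)
    (fun S S' h => by
      show cbS p ends a₂ b S + 1 ≤ cbS p ends a₂ b S' + 1
      linarith [cbS_mono p hp ends a₂ b h])
    (fun S S' h => by
      show cFS p ends a₂ o γ S + 2 ≤ cFS p ends a₂ o γ S' + 2
      linarith [cFS_mono p hp ends a₂ o γ h])
    (fun S => cbS_add_one_nonneg p hp ends a₂ b S) (fun S => cFS_add_two_nonneg p hp ends a₂ o hγ S)
  -- expand the shifted expectations
  have e1 : expect (Function.update p e 1) (fun ω => (cbS p ends a₂ b (cluster ends ω a₃) + 1) *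
      ((connEvent ends a₃ a₂)ᶜ).indicator 1 ω) =
      expect (Function.update p e 1) (fun ω => cbS p ends a₂ b (cluster ends ω a₃) *
        ((connEvent ends a₃ a₂)ᶜ).indicator 1 ω) +
        prob (Function.update p e 1) (connEvent ends a₃ a₂)ᶜ := by
    rw [prob_eq_expect_indicator, ← expect_add]
    congr 1; funext ω
    simp only [Pi.add_apply, Pi.one_apply, Set.indicator_apply]
    split_ifs <;> ring
  have e2 : expect (Function.update p e 1) (fun ω => (cFS p ends a₂ o γ (cluster ends ω a₃) + 2) *
      ((connEvent ends a₃ a₂)ᶜ).indicator 1 ω) =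
      expect (Function.update p e 1) (fun ω => cFS p ends a₂ o γ (cluster ends ω a₃) *
        ((connEvent ends a₃ a₂)ᶜ).indicator 1 ω) +
        2 * prob (Function.update p e 1) (connEvent ends a₃ a₂)ᶜ := by
    rw [prob_eq_expect_indicator, ← expect_const_mul, ← expect_add]
    congr 1; funext ω
    simp only [Pi.add_apply, Pi.one_apply, Set.indicator_apply]
    split_ifs <;> ring
  have e3 : expect (Function.update p e 1) (fun ω => (cbS p ends a₂ b (cluster ends ω a₃) + 1) *
      (cFS p ends a₂ o γ (cluster ends ω a₃) + 2) * ((connEvent ends a₃ a₂)ᶜ).indicator 1 ω) =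
      expect (Function.update p e 1) (fun ω =>
        (cbS p ends a₂ b (cluster ends ω a₃) * cFS p ends a₂ o γ (cluster ends ω a₃)) *
          ((connEvent ends a₃ a₂)ᶜ).indicator 1 ω) +
      2 * expect (Function.update p e 1) (fun ω => cbS p ends a₂ b (cluster ends ω a₃) *
        ((connEvent ends a₃ a₂)ᶜ).indicator 1 ω) +
      expect (Function.update p e 1) (fun ω => cFS p ends a₂ o γ (cluster ends ω a₃) *
        ((connEvent ends a₃ a₂)ᶜ).indicator 1 ω) +
      2 * prob (Function.update p e 1) (connEvent ends a₃ a₂)ᶜ := by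
    rw [prob_eq_expect_indicator, ← expect_const_mul, ← expect_const_mul, ← expect_add, ← expect_add,
      ← expect_add]
    congr 1; funext ω
    simp only [Pi.add_apply, Pi.one_apply, Set.indicator_apply]
    split_ifs <;> ring
  rw [e1, e2, e3] at key
  -- assemble `btwg` at `p[e ↦ 1]`
  unfold btwg
  rw [sum_termA_one p hends o b, sum_A_Su_one p hends b, sum_A_Su_one p hends o,
    sum_term_one_eq_expect p hends o b γ, sum_Ssig_one_eq_expect p hends b,
    sum_SFg_one_eq_expect p hends o γ, ← prob_one_compl_conn_eq_Q p hends]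
  simp only [zero_mul, zero_div, sub_zero, add_zero]
  have hQ0 := prob_nonneg hp₁ (connEvent ends a₃ a₂)ᶜ
  rcases eq_or_lt_of_le hQ0 with hz | hpos
  · -- `Q₁ = 0`: every fibre mass vanishes, so the first sum is `0` and `x / 0 = 0`
    rw [← hz, div_zero, sub_zero, ← sum_term_one_eq_expect p hends o b γ]
    refine Finset.sum_nonneg fun W _ => ?_
    have hm : mW (Function.update p e 1) ends a₁ a₂ a₃ W = 0 := by
      rw [← prob_one_cluster_inter_eq_mW p hends W]
      exact le_antisymm (le_trans (prob_mono hp₁ Set.inter_subset_right) hz.ge) (prob_nonneg hp₁ _)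
    rw [hm, div_zero]
  · rw [sub_nonneg, div_le_iff₀ hpos]
    nlinarith [key]

end Between

end RootEdge

end CovForm

end Summit.Ventures.PercRepro2
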